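import Summits.NavierStokesRegularity.NavierStokesRegularity.Theorems.ScalingDefectPeepholeDoorDefs
import Literature.Analysis.FluidPDE.PineauVicolOneSliceRegularityHolds

/-!
# ScalingDefectPeepholeDoorCriterion — door S30 «ScalingDefectPeepholeDoor» v2 (nsreg-p1 g24 ROUND-28 v2 6cf1a9889313ec10, texts
# `Theorems/ScalingDefectPeepholeDoorDefs.lean` = `r28/Sketch30v2.lean` 325dd7ac74e245e5), plate P3b: the CORE-VORTICITY CRITERION

`regularOfQuietCoreVorticity_holds : RegularOfQuietCoreVorticity` — Pineau–Vicol 2026 Prop. 9.5 with (9.14) as its hypothesis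
(arXiv:2607.09619 p. 32–33; lit §R146 (b): «IS IN PRINT ≈ verbatim»): for `C_u` there are `θ > 0` and `R ≥ 2`, and for every
annular pressure level `C_p` a lateness `s₂ ≥ 1`, such that a classical solution on `[−1,0) × B₁` in Pineau–Vicol's class
((1.15) + pointwise (1.16)) whose core vorticity is L²-small at ONE `t̄ ∈ (−e^{−s₂}, 0)`,
`∫_{B(0,2R√(−t̄))} |ω(t̄)|² ≤ θ²/(4√(−t̄))`, is bounded near `(0,0)`.

This is the body of the tree's `Literature.Analysis.FluidPDE.pineauVicol2026_oneSlice_regularity_of_core'`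
(`PineauVicolOneSliceReductionK2.lean`) AFTER its hB-slot, with hA := the tree's Lemma 9.4
`pineauVicol_smallVorticity_propagation`: universal `ε_CKN` (`pineauVicol_regular_of_zoom_small`), `θ = min(ϑ, √(ε_CKN/20))`,
`R = max(R₀, 4JK²/θ²)`, envelopes `K(C_u)`, `K₂(C_u)` (Lemma 9.2 / Cor. 9.3), and for `C_p` the levels `B_u(C_u)`, `B_p(C_u, C_p)`
(`exists_lintegral_pressure_rpow_threeHalves_le`), the scale `c₁`, `T₀`, lateness `s₂ = max(1, 1 − log T₀)`; then Lemma 9.4 at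
`t̄`, (9.15)–(9.16) (`exists_cknE_le_of_core_small`) and Prop. 9.5 + CKN for the zoom.  Plumbing of proved tree lemmas only.

Door S30 is a regularity CRITERION inside a HYPOTHETICAL local Type-I blow-up (item 0056 `NoTypeII` stays OPEN); nothing here
bears on NS regularity itself.
-/

noncomputable section

set_option linter.dupNamespace false

namespace Summit.NavierStokesRegularity.NavierStokesRegularity.Theorems.ScalingDefectPeepholeDoor

open MeasureTheory Set Function Filter Metric TopologicalSpace
open scoped ENNReal NNReal InnerProductSpace RealInnerProductSpace Topology
open Literature.Analysis Literature.Analysis.FluidPDE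

-- nested operator types
set_option maxSynthPendingDepth 3

/-- **P3b · the core-vorticity criterion `RegularOfQuietCoreVorticity` holds** (Pineau–Vicol 2026 Prop. 9.5 with (9.14) as
hypothesis, assembled from the tree exactly as in `pineauVicol2026_oneSlice_regularity_of_core'` after its hB-slot: Lemma 9.4
`pineauVicol_smallVorticity_propagation` at `t̄`, (9.15)–(9.16) `exists_cknE_le_of_core_small`, Prop. 9.5 + CKN
`pineauVicol_regular_of_zoom_small` for the zoom `u_c`, `c = min(√(−t̄), c₁/2, 1/32)`).
[cite: PineauVicol2026, Prop. 9.5 (9.14) and §9.2, arXiv:2607.09619 pp. 31–35] -/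
theorem regularOfQuietCoreVorticity_holds : RegularOfQuietCoreVorticity := by
  intro Cu hCu
  -- universal constants
  obtain ⟨ε, hε, Hzoom⟩ := pineauVicol_regular_of_zoom_small
  obtain ⟨J, hJ, Hglue⟩ := exists_cknE_le_of_core_small
  obtain ⟨K, hK0, HK⟩ := exists_forall_fderiv_le_of_typeI_of_bounds Cu
  obtain ⟨K₂, -, HK₂⟩ := exists_forall_iteratedFDeriv_le_of_typeI_of_bounds 2 Cu
  obtain ⟨ϑ, hϑ, HA⟩ := pineauVicol_smallVorticity_propagation
  -- `θ` with `10 θ² < ε`, `θ ≤ ϑ`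
  set θ : ℝ := min ϑ (Real.sqrt (ε / 20)) with hθ_def
  have hθ0 : 0 < θ := lt_min hϑ (Real.sqrt_pos.2 (by positivity))
  have hθϑ : θ ≤ ϑ := min_le_left _ _
  have hθε : 10 * θ ^ 2 < ε := by
    have h1 : θ ≤ Real.sqrt (ε / 20) := min_le_right _ _
    have h2 : θ ^ 2 ≤ ε / 20 := by
      calc θ ^ 2 ≤ (Real.sqrt (ε / 20)) ^ 2 := pow_le_pow_left₀ hθ0.le h1 2
        _ = ε / 20 := Real.sq_sqrt (by positivity)
    linarith
  obtain ⟨R₀, hR₀2, HA'⟩ := HA θ hθ0 hθϑ Cu K K₂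
  -- `R` with `J K² / (R/2) ≤ θ²`
  set R : ℝ := max R₀ (4 * J * K ^ 2 / θ ^ 2) with hR_def
  have hRR₀ : R₀ ≤ R := le_max_left _ _
  have hR2 : 2 ≤ R := hR₀2.trans hRR₀
  have hR0 : 0 < R := by linarith
  have hJR : J * K ^ 2 / (R / 2) ≤ θ ^ 2 := by
    have h1 : 4 * J * K ^ 2 / θ ^ 2 ≤ R := le_max_right _ _
    rw [div_le_iff₀ (by positivity)]
    rw [div_le_iff₀ (by positivity)] at h1
    nlinarith
  refine ⟨θ, hθ0, R, hR2, fun Cp hCp => ?_⟩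
  -- the global bounds `Bu(Cu)`, `Bp(Cu, Cp)` and the scale `c₁`
  obtain ⟨Bp, HBp⟩ := exists_lintegral_pressure_rpow_threeHalves_le Cu Cp
  set Tq : ℝ≥0∞ := ∫⁻ t in Ioo (-1 : ℝ) 0, ENNReal.ofReal ((-t) ^ (-(1 / 4 : ℝ))) with hTq
  set Xq : ℝ≥0∞ := ∫⁻ x in ball (0 : EuclideanSpace ℝ (Fin 3)) 1,
    ENNReal.ofReal (‖x‖ ^ (-(5 / 2 : ℝ))) with hXq
  set Bu : ℝ≥0∞ := ENNReal.ofReal (Cu ^ 3) * (Tq * Xq) with hBu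
  have hBut : Bu < ⊤ := ENNReal.mul_lt_top ENNReal.ofReal_lt_top
    (ENNReal.mul_lt_top lintegral_Ioo_neg_rpow_quarter_lt_top lintegral_ball_norm_rpow_lt_top)
  obtain ⟨c₁', hc₁', Hgrad'⟩ := HK Bu Bp hBut ENNReal.coe_lt_top
  obtain ⟨c₂, hc₂, Hgrad2⟩ := HK₂ Bu Bp hBut ENNReal.coe_lt_top
  set c₁ : ℝ := min c₁' c₂ with hc₁_def
  have hc₁ : 0 < c₁ := lt_min hc₁' hc₂
  obtain ⟨T₀, hT₀, hT₀1, HA''⟩ := HA' R hRR₀ c₁ hc₁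
  -- the lateness `s₂ = max 1 (1 − log T₀)`
  set s₂ : ℝ := max 1 (1 - Real.log T₀) with hs₂_def
  have hs₂1 : 1 ≤ s₂ := le_max_left _ _
  have hexp : Real.exp (-s₂) ≤ T₀ := by
    have h1 : -s₂ ≤ Real.log T₀ - 1 := by
      have := le_max_right 1 (1 - Real.log T₀)
      linarith
    calc Real.exp (-s₂) ≤ Real.exp (Real.log T₀ - 1) := Real.exp_le_exp.2 h1
      _ ≤ Real.exp (Real.log T₀) := Real.exp_le_exp.2 (by linarith)
      _ = T₀ := Real.exp_log hT₀
  refine ⟨s₂, hs₂1, fun u p hreg hI hP tb htb1 htb0 hcurl => ?_⟩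
  have htbT : -T₀ < tb := by linarith
  have htbm1 : -1 < tb := by linarith
  have hsq : 0 < Real.sqrt (-tb) := Real.sqrt_pos.2 (by linarith)
  -- the bounds of this solution
  have hBu_u : ∫⁻ w in Ioo (-1 : ℝ) 0 ×ˢ ball (0 : EuclideanSpace ℝ (Fin 3)) 1,
      ‖u w.1 w.2‖ₑ ^ (3 : ℕ) ≤ Bu := by
    refine le_trans (le_of_eq (lintegral_congr fun w => ?_)) (lintegral_typeI_cube_le hI)
    rw [← ofReal_norm, ENNReal.ofReal_pow (norm_nonneg _)]
  have hgradu : ∀ t ∈ Ioo (-1 : ℝ) 0, ∀ x : EuclideanSpace ℝ (Fin 3), ‖x‖ + Real.sqrt (-t) ≤ c₁ →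
      ‖fderiv ℝ (u t) x‖ ≤ K / (‖x‖ + Real.sqrt (-t)) ^ 2 := fun t ht x hx =>
    Hgrad' u p hreg hI hBu_u (HBp u p hreg hI hP) t ht x (hx.trans (min_le_left _ _))
  have hgrad2u : ∀ t ∈ Ioo (-1 : ℝ) 0, ∀ x : EuclideanSpace ℝ (Fin 3), ‖x‖ + Real.sqrt (-t) ≤ c₁ →
      ‖iteratedFDeriv ℝ 2 (u t) x‖ ≤ K₂ / (‖x‖ + Real.sqrt (-t)) ^ 3 := fun t ht x hx =>
    Hgrad2 u p hreg hI hBu_u (HBp u p hreg hI hP) t ht x (hx.trans (min_le_right _ _))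
  -- Lemma 9.4 at `t̄`: the small core dissipation
  have hcore := HA'' u p hreg hI hgradu hgrad2u tb ⟨htbT, htb0⟩ hcurl
  -- (9.15)–(9.16): `E(r; u) ≤ 10 θ²` for `r ≤ r₀`
  have hO : IsOpen (Ioo (-1 : ℝ) 0 ×ˢ ball (0 : EuclideanSpace ℝ (Fin 3)) 1) :=
    isOpen_Ioo.prod isOpen_ball
  have hreg' := hreg.mono_of_isOpen (prod_mono Ioo_subset_Ico_self Subset.rfl) hO
  have hcont : ContinuousOn (fun w : ℝ × EuclideanSpace ℝ (Fin 3) => fderiv ℝ (u w.1) w.2)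
      (Ioo (-1 : ℝ) 0 ×ˢ ball (0 : EuclideanSpace ℝ (Fin 3)) 1) :=
    continuousOn_fderiv_slice_of_isOpen hO hreg'.smooth_velocity (by exact_mod_cast le_top)
  have hcore' : ∀ t ∈ Ioo (-(-tb)) 0,
      ∫⁻ x in ball (0 : EuclideanSpace ℝ (Fin 3)) (R / 2 * Real.sqrt (-t)),
          ENNReal.ofReal (frobeniusNormSq (fderiv ℝ (u t) x)) ≤
        ENNReal.ofReal (4 * θ ^ 2 / Real.sqrt (-t)) := by
    intro t ht
    exact hcore t ⟨by linarith [ht.1], ht.2⟩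
  have hE : ∀ r : ℝ, 0 < r → r ≤ Real.sqrt (-tb) → r ≤ c₁ / 2 → r ≤ 1 →
      cknE r (0 : ℝ × EuclideanSpace ℝ (Fin 3)) (fun t x => fderiv ℝ (u t) x) ≤
        ENNReal.ofReal (10 * θ ^ 2) :=
    Hglue u θ K c₁ (R / 2) (-tb) hθ0 hK0 hc₁ (by positivity) (by linarith) hcont hcore' hgradu hJR
  -- the zoom factor
  set c : ℝ := min (min (Real.sqrt (-tb)) (c₁ / 2)) (1 / 32) with hc_def
  have hc0 : 0 < c := lt_min (lt_min hsq (by positivity)) (by norm_num)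
  have hc32 : c ≤ 1 / 32 := min_le_right _ _
  have hcsq : c ≤ Real.sqrt (-tb) := (min_le_left _ _).trans (min_le_left _ _)
  have hcc₁ : c ≤ c₁ / 2 := (min_le_left _ _).trans (min_le_right _ _)
  have hsup : (⨆ r ∈ Ioo (0 : ℝ) 1,
      cknE r (0 : ℝ × EuclideanSpace ℝ (Fin 3)) (fun t x => fderiv ℝ (nsRescale c u t) x)) <
        ENNReal.ofReal ε := by
    refine lt_of_le_of_lt (iSup₂_le fun r hr => ?_) ((ENNReal.ofReal_lt_ofReal_iff hε).2 hθε)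
    have h3 : stAffine (c ^ 2) c 0 (0 : EuclideanSpace ℝ (Fin 3)) (0 : ℝ × EuclideanSpace ℝ (Fin 3)) = 0 := by
      simp [stAffine]
    rw [fderiv_nsRescale_eq_smul_stPull, cknE_nsZoom hc0 hr.1 0 0 0, h3]
    refine hE (c * r) (mul_pos hc0 hr.1) ?_ ?_ ?_
    · calc c * r ≤ c * 1 := by gcongr; exact hr.2.le
        _ ≤ Real.sqrt (-tb) := by rw [mul_one]; exact hcsq
    · calc c * r ≤ c * 1 := by gcongr; exact hr.2.le
        _ ≤ c₁ / 2 := by rw [mul_one]; exact hcc₁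
    · calc c * r ≤ c * 1 := by gcongr; exact hr.2.le
        _ ≤ 1 := by rw [mul_one]; linarith
  exact Hzoom u p Cu Cp c hreg hI hP hc0 hc32 hsup

end Summit.NavierStokesRegularity.NavierStokesRegularity.Theorems.ScalingDefectPeepholeDoor

end
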